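import Mathlib
import Summits.Ventures.PercRepro2.CoinTreeCore
import Summits.Ventures.PercRepro2.CoinOrTailKDefs
import Summits.Ventures.PercRepro2.CoinChainMarkerACoins

/-!
# The first marker at the OR-vertex `a'` with THREE `a'`-entries: an instantiation (blind cell
PercRepro2, night-2 g17; NIGHT2-DARC.md §57.8)

Thirteen coins on `Fin 10` (s = 0, m₂ = 1, r₁ = 2, r₂ = 3, r₃ = 4, a′ = 5, a = 6, w = 7, h = 8,
t = 9): the out-tree core `s → {m₂, r₁, r₂, r₃}`, the OR-vertex `a′` entered from `r₁, r₂, r₃`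
(three random coins — the AND-switch with THREE entries), the free-arc vertex `a` entered from
`a′` (the chain coin) and from `m₂`, the head `a′ → h → t`, `a → t`, `w → t`.  Row 2′DARC at
`a → w` for the markers `(a′, m₂)` for EVERY probability vector, no hypothesis
(`darc_chainMarkerA'_example`).
-/

namespace Summit.Ventures.PercRepro2.Coin

namespace ChainMarkerAExample

open Classical

/-- The thirteen coins of the example. -/
def arcsCA : Fin 13 → Finset (Fin 10 × Fin 10)
  | 0 => {(0, 1)}   -- s → m₂
  | 1 => {(0, 2)}   -- s → r₁
  | 2 => {(0, 3)}   -- s → r₂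
  | 3 => {(0, 4)}   -- s → r₃
  | 4 => {(2, 5)}   -- r₁ → a′
  | 5 => {(3, 5)}   -- r₂ → a′
  | 6 => {(4, 5)}   -- r₃ → a′
  | 7 => {(5, 6)}   -- a′ → a  (the chain arc)
  | 8 => {(1, 6)}   -- m₂ → a
  | 9 => {(5, 8)}   -- a′ → h
  | 10 => {(8, 9)}  -- h → t
  | 11 => {(6, 9)}  -- a → t
  | 12 => {(7, 9)}  -- w → t
  | _ => ∅

/-- The entry coins of `a′`. -/
def c'CA : Fin 10 → Fin 13
  | 2 => 4
  | 3 => 5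
  | 4 => 6
  | _ => 0

/-- The entry coins of `a`. -/
def cCA : Fin 10 → Fin 13
  | 5 => 7
  | 1 => 8
  | _ => 0

/-- The tree coins. -/
def tcCA : Fin 10 → Fin 13
  | 1 => 0
  | 2 => 1
  | 3 => 2
  | 4 => 3
  | _ => 0

/-- The parent map. -/
def parCA : Fin 10 → Fin 10 := fun _ => 0

/-- The rank. -/
def rkCA : Fin 10 → ℕ
  | 1 => 1
  | 2 => 1
  | 3 => 1
  | 4 => 1
  | _ => 0

/-- Every coin is a single arc. -/
lemma sameEnds_ca : SameEnds arcsCA := by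
  intro e xy hxy x'y' hx'y'
  fin_cases e <;> simp [arcsCA] at hxy hx'y' <;> subst hxy <;> subst hx'y' <;>
    exact ⟨Or.inl rfl, Or.inr rfl⟩

set_option maxRecDepth 20000 in
/-- The out-tree core `{m₂, r₁, r₂, r₃}`. -/
lemma treeCore_ca : TreeCore arcsCA 0 {1, 2, 3, 4} tcCA parCA rkCA where
  tree := by decide
  par_mem := by decide
  rank := by decide
  into_C := by decide
  into_s := by decide
  s_notin := by decide

set_option maxRecDepth 20000 in
/-- `a′ = 5` is an OR-vertex of the core entered from `r₁, r₂, r₃`. -/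
lemma orTailK'_ca : OrTailK arcsCA 0 {1, 2, 3, 4} {2, 3, 4} c'CA 5 where
  ent_sub := by decide
  s_notin := by decide
  a_notin := by decide
  a_ne_s := by decide
  into_U := by decide
  into_s := by decide
  into_a := by decide
  arcs_c := by decide
  c_inj := by decide

set_option maxRecDepth 20000 in
/-- `a = 6` is an OR-vertex of `U ∪ {a′}` entered from `a′` and `m₂`. -/
lemma orTailK_ca : OrTailK arcsCA 0 (insert 5 {1, 2, 3, 4}) {5, 1} cCA 6 where
  ent_sub := by decide
  s_notin := by decide
  a_notin := by decide
  a_ne_s := by decide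
  into_U := by decide
  into_s := by decide
  into_a := by decide
  arcs_c := by decide
  c_inj := by decide

/-- **Row 2′DARC at `a → w` for the markers `(a′, m₂)` on the thirteen-coin instance with three
`a′`-entries, every probability vector — no hypothesis.** -/
theorem darc_chainMarkerA'_example {R : Type*} [Field R] [LinearOrder R] [IsStrictOrderedRing R]
    (pr : Fin 13 → R) (hp : IsProbVec pr) : DARC pr arcsCA 0 {9} 5 1 6 7 :=
  darc_of_chainTreeMarkerA'_coins pr hp sameEnds_ca orTailK'_ca orTailK_ca treeCore_ca (by decide)
    (by decide) (by decide) (by decide) (by decide) (by decide)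

end ChainMarkerAExample

end Summit.Ventures.PercRepro2.Coin
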